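import Literature.Computability.MetaComplexity.BlockCanonicalClosure
import Literature.Computability.MetaComplexity.BinaryPigeonholeResLinRank
import Literature.Computability.MetaComplexity.ResLinWidth
import Literature.Computability.MetaComplexity.BlockClosureFreeness
import Mathlib.Data.Set.Card.Arithmetic
import Mathlib.Analysis.SpecialFunctions.Pow.Real
import Mathlib.Analysis.SpecialFunctions.Log.Base
import HarnessLib

/-!
# Closure-local union stability (CLUS) for the functional binary pigeonhole principle `CBPHP^{N,M}_{k,f}`
(the vocabulary of the layer-counting argument of Alekseev–Gaevoy, ECCC TR26-007, §4.3)

Topic `Computability/MetaComplexity` (Res(⊕) proof complexity; companions `BlockCanonicalClosure.lean`,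
`BinaryPigeonholeResLinRank.lean`, `ResLinWidth.lean`). DEFINITIONS and PROVED set-theoretic lemmas
only; no statement is asserted here. Requested by the definition item `defn-ClosureLocalUnionStable`
(cell pnp-ideate, rung F-N1; the closed route-side statements `CLUSForall`, `CLUSExists`,
`CLUSExistsCapped`, `CLUSPolylog`, `CLUSTExistsCapped`, `ExistsGoodF`, `AffinePairDichotomy`,
`AvoidanceCapacity` and the implications between them are NOT in this file — they are route-posited
objects and live Summits-side, `Summits/PneNP/PneNP/Theorems/…`, D-0016/D-0026).

**Source and what is verbatim.** Y. Alekseev, N. Gaevoy, *New Polynomial-Depth Res(⊕) Lower Bounds*,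
ECCC TR26-007 (2026) [AlekseevGaevoy2026b] prove (Thm 1.1 = Thm 4.3, p. 12) a depth lower bound
`Ω(N^{(k−2)c})` for Res(⊕) refutations of size `≤ 2^{(log N)^{q/2}}` of the functional binary pigeonhole
principle `CBPHP^{N,M}_{k,f}` (§3, p. 10: pigeons `x < N` written in binary with `log M` bits each;
axioms: no two pigeons in one hole, and no `k+1` pigeons whose holes form a tuple of the symmetrised graph
`Sym_f` of `f : [M]^k → [M]`, §3.1 (i)–(ii), pp. 10–11) CONDITIONALLY on their union-stability
Conjecture 4.2 (= Conj. 1.4) — which is false (tree: `Summit.PneNP.PneNP.Theorems.not_unionStabilityConjecture`,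
`ResLinUnionStability.lean`, middle-layer family). The printed proof of Thm 4.3 (§4.3, pp. 15–16) uses
Conj. 4.2 exactly once (p. 16, l. 1: "So, if we assume the Conjecture 4.2, we get that
|⋃ Ψ^ρ_j| ≥ |⋃ Φ^ρ_j|·(1 − …)^c"), and only for families of a special shape: the members are the
NICE-solution sets (Def. 4.5, p. 13: a solution of the linear system `L_j` of a DAG vertex with no violated
axiom among the pigeons of the closure `Cl(L_j)`) of systems of rank `≤ w`, and the deleted part of member
`j` is the set `Φ^ρ_j ∖ Ψ^ρ_j` of nice solutions that acquire a violated axiom inside the closure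
`Cl(L_j ∪ {ℓ_j})` after ONE more linear query `ℓ_j` (§4.3, p. 15), a `μ = (3w)^{k+1}(log N)^{O(1)}/N^{k−1−ε}`
fraction by their Lemma 4.6 (p. 13). The closure `Cl` is the canonical block closure of
Efremenko–Garlík–Itsykson (STOC 2024, §4) [EfremenkoGarlikItsykson2024] = TR26-007 §2.3 (Lemmas 2.6–2.9),
in the tree `canClosure` (`BlockCanonicalClosure.lean`).

This file renders that vocabulary over the tree's `ℕ`-indexed Res(⊕) toolkit (`LinLit`, `LinLit.eval`,
`holeOf`, `canClosure`, `linClauseRank`): the printed notions `SymF` (§3.1 (ii) `Sym_f`), `PropI`/`PropII`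
(§3.1 (i),(ii)), `CollIn` (a violated axiom inside a pigeon set, §3/Def. 4.5), `cl` (the closure of a
system), `Nice` (Def. 4.5), `Survives` (membership of `Ψ^ρ_j`, §4.3 p. 15); and — NOT verbatim in print,
introduced by the cell pnp-ideate (planner seat p1, 2026-08-25) as the closure-local WEAKENING of the
hypothesis of Conj. 4.2 that p. 16 l. 1 actually consumes — the stability predicates `FamilyStable`,
`ClosureLocalUnionStableAt` (member-count-free), `ClosureLocalUnionStableCapped` (member cap `g`, the
form literally used on p. 15), their tuple-only variants `FamilyStableT`, `ClosureLocalUnionStableCappedT`,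
and the parameter abbreviations of Thm 4.3's regime `wOf` (rank budget `((log₂N)^{q/2} + log₂N)²`, p. 15),
`gOf` (member cap `2^{(log₂N)^{q/2}}` = the size bound), `mOf` (bits per pigeon, `M = 2^m ≥ N^{k−1−ε}`),
`muOf` (the Lemma-4.6 loss `(log₂N)^C/N^{k−1−ε}`).

PROVED here (standard axioms), as API of the printed notions: monotonicity of the collision
predicate and of the closure (`collIn_mono`; `cl_mono` = TR26-007 Lemma 2.7), and the locality reading of
p. 15 — a nice assignment with no collision on a pigeon set containing its one-query closure survives
(`survives_of_nice_of_not_collIn`), hence `⋃ Nice ⊆ ⋃ Survives ∪ Coll(Q)` and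
`|⋃ Nice| ≤ |⋃ Survives| + |Coll(Q)|` when all one-query closures lie in `Q` (`ncard_union_nice_le`).
NOT here (new results of the cell about these notions — the trap reformulation of the lost set, the
tuple/pair split `familyStable_of_T`, the Markov bound `|⋃Nice ∖ ⋃Surv| ≤ μ·Σ_i |Nice_i|`, monotonicity
in the loss parameter, the asymptotics of `muOf`, and the closed statements listed above with their
implications): they belong Summits-side (`Summits/PneNP/PneNP/Theorems/`), in a file importing this one;
a checked companion `ClosureLocalUnionStabilityTheorems.lean` (namespace
`Summit.PneNP.PneNP.Theorems.CLUS`) is deposited with the cell record for a prover to land.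

## References

* Y. Alekseev, N. Gaevoy, *New Polynomial-Depth Res(⊕) Lower Bounds*, ECCC TR26-007 (2026): §3 (p. 10,
  `CBPHP^{N,M}_{k,f}`), §3.1 (i)–(ii) (pp. 10–11), §2.3 (closure, Lemmas 2.6–2.9), Def. 4.5 (p. 13, nice
  solutions), Lemma 4.6 (p. 13), Thm 4.3 (p. 12) and its proof §4.3 (pp. 15–16) [AlekseevGaevoy2026b]
  (held: `lit read paper:url-9096d7ef0edf`).
* K. Efremenko, M. Garlík, D. Itsykson, *Lower bounds for regular resolution over parities*, STOC 2024,
  §4 (closure) [EfremenkoGarlikItsykson2024].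
* Cell record: `run/shared/lean/pub/pnp-ideate/pnp-ideate-p1/{ROUND-1.md, ROUND-2.md, Sketch-CLUS-v4.lean}`
  (this file = the definitional and proved part of `Sketch-CLUS-v4.lean`, namespace moved from
  `Summit.PneNP.PneNP.Sketch.CLUS`; statements byte-identical otherwise).
-/

namespace Literature.Computability.MetaComplexity.CLUS

/-- A hole = an `m`-bit string.
[cite: AlekseevGaevoy2026b, §3 (p. 10: holes [M], M = 2^m, pigeons written in binary)] -/
abbrev Hole (m : ℕ) : Type := Fin m → Bool

/-- Extension of a finite assignment of the `n = N·m` pigeon bits to all of `ℕ` (false elsewhere),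
so that the tree's `ℕ`-indexed Res(⊕) vocabulary (`LinLit.eval`, `holeOf`, `canClosure`) applies.
[folklore] -/
def ext (n : ℕ) (σ : Fin n → Bool) : ℕ → Bool :=
  fun v => if h : v < n then σ ⟨v, h⟩ else false

/-- The symmetrised graph of `f` (TR26-007 §3.1 (ii), `Sym_f`): a `(k+1)`-tuple of holes is in
`Sym_f` iff some permutation of it has the form `(h₁,…,h_k, f(h₁,…,h_k))`.
[cite: AlekseevGaevoy2026b, §3.1 (ii) (pp. 10–11, Sym_f)] -/
def SymF {m k : ℕ} (f : (Fin k → Hole m) → Hole m) (t : Fin (k + 1) → Hole m) : Prop :=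
  ∃ π : Equiv.Perm (Fin (k + 1)),
    f (fun i => t (π (Fin.castSucc i))) = t (π (Fin.last k))

/-- Property (ii) of TR26-007 §3.1: every fibre of `Sym_f` over `k` fixed holes has at most
`(log M)^k = m^k` elements. [cite: AlekseevGaevoy2026b, §3.1 (ii) (pp. 10–11)] -/
def PropII (m k : ℕ) (f : (Fin k → Hole m) → Hole m) : Prop :=
  ∀ h : Fin k → Hole m, ({y : Hole m | SymF f (Fin.snoc h y)} : Set (Hole m)).ncard ≤ m ^ k

/-- Property (i) of TR26-007 §3.1 in the sufficient form used there (§3, p. 10: "for any `S ⊆ [M]`,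
`|S| = N − 1`, the size of the image of `S^k` under `f` is equal to `M`"), which makes
`CBPHP^{N,M}_{k,f}` unsatisfiable. [cite: AlekseevGaevoy2026b, §3.1 (i) (pp. 10–11)] -/
def PropI (N m k : ℕ) (f : (Fin k → Hole m) → Hole m) : Prop :=
  ∀ S : Finset (Hole m), S.card = N - 1 → ∀ y : Hole m, ∃ h : Fin k → Hole m, (∀ i, h i ∈ S) ∧ f h = y

/-- A COLLISION of the assignment `σ` INSIDE the pigeon set `P` (pigeons are `< N`): two distinct
pigeons of `P` in the same hole, or `k+1` distinct pigeons of `P` whose holes form a tuple of the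
(symmetrised) graph of `f` — i.e. a violated axiom of `CBPHP^{N,M}_{k,f}` mentioning only pigeons of
`P` (TR26-007 §3 and Def. 4.5). `holeOf m σ x` is the tree's block read-out (bits `x·m + j`).
[cite: AlekseevGaevoy2026b, §3 (p. 10, the two axiom families of CBPHP) and Def. 4.5 (p. 13)] -/
def CollIn (N m k : ℕ) (f : (Fin k → Hole m) → Hole m) (P : Finset ℕ) (σ : ℕ → Bool) : Prop :=
  (∃ x ∈ P, ∃ y ∈ P, x ≠ y ∧ x < N ∧ y < N ∧ holeOf m σ x = holeOf m σ y) ∨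
  (∃ t : Fin (k + 1) → ℕ, Function.Injective t ∧ (∀ i, t i ∈ P ∧ t i < N) ∧
    SymF f (fun i => holeOf m σ (t i)))

/-- The closure of a linear system `F` with respect to the pigeon blocks of `m` bits: the tree's
canonical (least-maximiser) block closure of the span of the forms of `F`
(Efremenko–Garlík–Itsykson 2024 §4; = `Cl(F)` of TR26-007 §2.3).
[cite: AlekseevGaevoy2026b, §2.3 (closure, Lemmas 2.6–2.9; = Efremenko–Garlík–Itsykson 2024 §4, the tree's `canClosure`)] -/
noncomputable def cl (m : ℕ) (F : Finset LinLit) : Finset ℕ :=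
  canClosure m (Submodule.span (ZMod 2) (LinClause.forms F))

/-- `σ` satisfies every equation of the linear system `F` (a substitution "that satisfies L", Def. 4.5).
[cite: AlekseevGaevoy2026b, Def. 4.5 (p. 13)] -/
def Sat (F : Finset LinLit) (σ : ℕ → Bool) : Prop := ∀ e ∈ F, LinLit.eval σ e = true

/-- All variables of `F` are pigeon bits (`< n = N·m`): `F` is a system "over the variables of
`CBPHP^{N,M}_{k,f}`" (§3: `N` pigeons of `log M` bits each). [cite: AlekseevGaevoy2026b, §3 (p. 10) and Def. 4.5 (p. 13)] -/
def Supported (n : ℕ) (F : Finset LinLit) : Prop := ∀ e ∈ F, ∀ v ∈ e.1, v < n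

/-- TR26-007 Def. 4.5: `σ` is NICE for `F` — a solution of `F` with no collision inside `Cl(F)`.
[cite: AlekseevGaevoy2026b, Def. 4.5 (p. 13, nice solution)] -/
def Nice (N m k : ℕ) (f : (Fin k → Hole m) → Hole m) (F : Finset LinLit) (σ : ℕ → Bool) : Prop :=
  Sat F σ ∧ ¬ CollIn N m k f (cl m F) σ

/-- TR26-007 §4.3 (`Ψ^ρ_j`): `σ` is nice for `F` and SURVIVES the query of the form `ℓ` — no collision
inside the larger closure `Cl(F ∪ {ℓ})` (the closure depends on the forms only, so the answer bit is
immaterial; we insert `(ℓ, true)`). [cite: AlekseevGaevoy2026b, §4.3 (p. 15, the sets Ψ^ρ_j)] -/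
def Survives (N m k : ℕ) (f : (Fin k → Hole m) → Hole m) (F : Finset LinLit) (ℓ : Finset ℕ)
    (σ : ℕ → Bool) : Prop :=
  Nice N m k f F σ ∧ ¬ CollIn N m k f (cl m (insert (ℓ, true) F)) σ

/-- The PIECE of `σ₀` for the pigeon set `C`: assignments agreeing with `σ₀` on every pigeon of `C`
(TR26-007 §4.3 splits the nice set `Φ_j` into the affine pieces `Φ^ρ_j`, `ρ` = the assignment of the
closure pigeons; Lemma 4.6 is proved piece by piece: "|Φ′_ρ| ≥ |Φ_ρ|·(1 − …)", p. 13).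
[cite: AlekseevGaevoy2026b, §4.3 (p. 15, the closure assignments ρ)] -/
def SamePiece (m : ℕ) (C : Finset ℕ) (σ₀ σ : ℕ → Bool) : Prop := ∀ x ∈ C, holeOf m σ x = holeOf m σ₀ x

/-- **Stability of ONE family** of (system, query-form) pairs `(L i, ℓ i)`, `i : ι`, over the `N·m`
pigeon bits with `rk L i ≤ w`: IF every member retains a `(1-μ)` fraction of its nice solutions after
its query ON EVERY CLOSURE PIECE (for `f` with property (ii) this is exactly what the proof of TR26-007
Lemma 4.6 gives, with `μ = (3w)^{k+1}(log N)^{O(1)}/N^{k-1-ε}`) and the nice sets cover at least half of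
the cube, THEN the surviving sets cover a `(1-λ)` fraction of what the nice sets cover. (`ι` is any index
type — the sets counted are subsets of the finite cube `Fin (N·m) → Bool`, so no `ncard` is junk; the
closed route-side statements quantify over `Fintype ι`, with or without a bound on `Fintype.card ι`.)
(Stability predicate introduced for this formalisation — the closure-local weakening of the hypothesis
of Conj. 4.2; the cited passage is the one instance the printed proof consumes.)
[cite: AlekseevGaevoy2026b, §4.3 (proof of Thm. 4.3, pp. 15–16; use of Conj. 4.2 at p. 16, l. 1)] -/
def FamilyStable (N m k : ℕ) (f : (Fin k → Hole m) → Hole m) (w : ℕ) (μ lam : ℝ)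
    (ι : Type) (L : ι → Finset LinLit) (ℓ : ι → Finset ℕ) : Prop :=
    (∀ i, Supported (N * m) (L i) ∧ (∀ v ∈ ℓ i, v < N * m) ∧ linClauseRank (L i) ≤ w) →
    (∀ i, ∀ σ₀ : Fin (N * m) → Bool,
      (1 - μ) * (({σ : Fin (N * m) → Bool | SamePiece m (cl m (L i)) (ext (N * m) σ₀) (ext (N * m) σ) ∧
          Nice N m k f (L i) (ext (N * m) σ)} : Set _).ncard : ℝ)
        ≤ (({σ : Fin (N * m) → Bool | SamePiece m (cl m (L i)) (ext (N * m) σ₀) (ext (N * m) σ) ∧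
          Survives N m k f (L i) (ℓ i) (ext (N * m) σ)} : Set _).ncard : ℝ)) →
    2 ^ (N * m - 1) ≤ ({σ : Fin (N * m) → Bool | ∃ i, Nice N m k f (L i) (ext (N * m) σ)} : Set _).ncard →
    (1 - lam) * (({σ : Fin (N * m) → Bool | ∃ i, Nice N m k f (L i) (ext (N * m) σ)} : Set _).ncard : ℝ)
      ≤ (({σ : Fin (N * m) → Bool | ∃ i, Survives N m k f (L i) (ℓ i) (ext (N * m) σ)} : Set _).ncard : ℝ)

/-- **CLUS at one parameter point, member-count-free**: every FINITE family (any index type `ι`, no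
bound on its cardinality) of rank-`≤ w` systems with one query each is stable in the sense of
`FamilyStable`.
(Introduced for this formalisation; not verbatim in print.) [cite: AlekseevGaevoy2026b, §4.3 (proof of Thm. 4.3, pp. 15–16)] -/
def ClosureLocalUnionStableAt (N m k : ℕ) (f : (Fin k → Hole m) → Hole m) (w : ℕ) (μ lam : ℝ) :
    Prop :=
  ∀ (ι : Type) (_ : Fintype ι) (L : ι → Finset LinLit) (ℓ : ι → Finset ℕ),
    FamilyStable N m k f w μ lam ι L ℓ

/-- **CLUS with a member cap `g`** — exactly what TR26-007 p. 15 consumes: there the systems are the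
`g ≤ S` vertices of one layer of a refutation of size `S ≤ 2^{(log N)^{q/2}}` (the high-rank ones having
been discarded by the union bound `S · M^N · 2^{-(log S + log N)^2} ≤ K_i / N^{2k}`). Weaker than the
member-count-free form.
(Introduced for this formalisation; not verbatim in print.)
[cite: AlekseevGaevoy2026b, §4.3 (proof of Thm. 4.3, p. 15: one layer of a size-S refutation)] -/
def ClosureLocalUnionStableCapped (N m k : ℕ) (f : (Fin k → Hole m) → Hole m) (w g : ℕ)
    (μ lam : ℝ) : Prop :=
  ∀ (ι : Type) (_ : Fintype ι), Fintype.card ι ≤ g → ∀ (L : ι → Finset LinLit) (ℓ : ι → Finset ℕ),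
    FamilyStable N m k f w μ lam ι L ℓ

/-- Abbreviation: the rank budget actually used on p. 15, `w_N = (log₂ S + log₂ N)^2` at the maximal size
`S = 2^{(log₂ N)^{q/2}}`, i.e. `((log₂ N)^{q/2} + log₂ N)^2` (`= (1+o(1))·(log₂ N)^q` for `q > 2`).
[cite: AlekseevGaevoy2026b, §4.3 (p. 15, rank threshold (log S + log N)^2) with Thm. 4.3 (p. 12, S ≤ 2^((log N)^(q/2)))] -/
noncomputable def wOf (q : ℝ) (N : ℕ) : ℝ := ((Real.logb 2 N) ^ (q / 2) + Real.logb 2 N) ^ 2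

/-- Abbreviation: the member cap `g_N = ⌊2^{(log₂ N)^{q/2}}⌋` (= the size bound `S` of Thm 4.3).
[cite: AlekseevGaevoy2026b, Thm. 4.3 (p. 12, size bound 2^((log N)^(q/2)))] -/
noncomputable def gOf (q : ℝ) (N : ℕ) : ℕ := ⌊(2 : ℝ) ^ ((Real.logb 2 N) ^ (q / 2))⌋₊

/-- Abbreviation: the bit budget `m_N = ⌈(k-1-ε)·log₂ N⌉` (so `M = 2^{m_N} ≥ N^{k-1-ε}`).
[cite: AlekseevGaevoy2026b, Thm. 4.3 (p. 12, M versus N) and §3.1 (N ≥ M^(1/(k−1)+ε))] -/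
noncomputable def mOf (k : ℕ) (ε : ℝ) (N : ℕ) : ℕ := ⌈((k : ℝ) - 1 - ε) * Real.logb 2 N⌉₊

/-- Abbreviation: the Lemma-4.6 retention loss `μ_N = (log₂ N)^C / N^{k-1-ε}`.
[cite: AlekseevGaevoy2026b, Lemma 4.6 (p. 13, retention loss (3w)^(k+1)(log N)^O(1)/N^(k−1−ε))] -/
noncomputable def muOf (k : ℕ) (ε C : ℝ) (N : ℕ) : ℝ :=
  (Real.logb 2 N) ^ C / (N : ℝ) ^ ((k : ℝ) - 1 - ε)

/-! ### Locality
If every one-query closure of the family lies inside a pigeon set `Q`, then a nice point with no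
violated axiom inside `Q` survives in the SAME member; hence `⋃ Nice ⊆ ⋃ Survives ∪ Coll(Q)` and
`|⋃ Nice| ≤ |⋃ Survives| + |Coll(Q)|`, with no retention hypothesis and no bound on the number of
members. -/

/-- API: the collision predicate of Def. 4.5 / Lemma 4.6 ("collisions on the pigeons from `P`") is monotone
in the pigeon set `P`. [cite: AlekseevGaevoy2026b, Def. 4.5 and Lemma 4.6 (p. 13)] -/
theorem collIn_mono {N m k : ℕ} {f : (Fin k → Hole m) → Hole m} {P Q : Finset ℕ} {σ : ℕ → Bool}
    (hPQ : P ⊆ Q) (h : CollIn N m k f P σ) : CollIn N m k f Q σ := by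
  rcases h with ⟨x, hx, y, hy, hxy, hxN, hyN, hh⟩ | ⟨t, ht, htP, hS⟩
  · exact Or.inl ⟨x, hPQ hx, y, hPQ hy, hxy, hxN, hyN, hh⟩
  · exact Or.inr ⟨t, ht, fun i => ⟨hPQ (htP i).1, (htP i).2⟩, hS⟩

/-- API: a nice assignment with no collision on a pigeon set `Q ⊇ Cl(L ∪ {ℓ})` is in `Ψ^ρ` (survives the
query) — the reading of the definition of `Ψ^ρ_j` on p. 15. [cite: AlekseevGaevoy2026b, §4.3 (p. 15, Ψ^ρ_j)] -/
theorem survives_of_nice_of_not_collIn {N m k : ℕ} {f : (Fin k → Hole m) → Hole m}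
    {F : Finset LinLit} {ℓ : Finset ℕ} {Q : Finset ℕ} {σ : ℕ → Bool}
    (hQ : cl m (insert (ℓ, true) F) ⊆ Q) (hnice : Nice N m k f F σ) (hno : ¬ CollIn N m k f Q σ) :
    Survives N m k f F ℓ σ :=
  ⟨hnice, fun h => hno (collIn_mono hQ h)⟩

/-- Locality: `⋃ Nice ⊆ ⋃ Survives ∪ Coll(Q)` when every one-query closure lies inside `Q` (the
closure-local structure of the deletions `Φ^ρ_j ∖ Ψ^ρ_j` in the proof of Thm 4.3).
[cite: AlekseevGaevoy2026b, §4.3 (proof of Thm. 4.3, p. 15)] -/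
theorem union_nice_subset_union_survives_union_coll {N m k : ℕ} {f : (Fin k → Hole m) → Hole m}
    {ι : Type} (L : ι → Finset LinLit) (ℓ : ι → Finset ℕ) (Q : Finset ℕ)
    (hQ : ∀ i, cl m (insert (ℓ i, true) (L i)) ⊆ Q) :
    {σ : Fin (N * m) → Bool | ∃ i, Nice N m k f (L i) (ext (N * m) σ)} ⊆
      {σ | ∃ i, Survives N m k f (L i) (ℓ i) (ext (N * m) σ)} ∪
        {σ | CollIn N m k f Q (ext (N * m) σ)} := by
  rintro σ ⟨i, hi⟩
  by_cases hc : CollIn N m k f Q (ext (N * m) σ)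
  · exact Or.inr hc
  · exact Or.inl ⟨i, survives_of_nice_of_not_collIn (hQ i) hi hc⟩

/-- Locality, counted: `|⋃ Nice| ≤ |⋃ Survives| + |Coll(Q)|` when every one-query closure lies inside
`Q` (no retention hypothesis, no member count). [cite: AlekseevGaevoy2026b, §4.3 (proof of Thm. 4.3, p. 15)] -/
theorem ncard_union_nice_le {N m k : ℕ} {f : (Fin k → Hole m) → Hole m}
    {ι : Type} (L : ι → Finset LinLit) (ℓ : ι → Finset ℕ) (Q : Finset ℕ)
    (hQ : ∀ i, cl m (insert (ℓ i, true) (L i)) ⊆ Q) :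
    ({σ : Fin (N * m) → Bool | ∃ i, Nice N m k f (L i) (ext (N * m) σ)} : Set _).ncard ≤
      ({σ : Fin (N * m) → Bool | ∃ i, Survives N m k f (L i) (ℓ i) (ext (N * m) σ)} : Set _).ncard +
        ({σ : Fin (N * m) → Bool | CollIn N m k f Q (ext (N * m) σ)} : Set _).ncard :=
  le_trans (Set.ncard_le_ncard (union_nice_subset_union_survives_union_coll L ℓ Q hQ) (Set.toFinite _))
    (Set.ncard_union_le _ _)

/-- The span of the (finitely many) forms of a finite system is a finite module. [folklore] -/
instance instFiniteSpanForms (F : Finset LinLit) :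
    Module.Finite (ZMod 2) (Submodule.span (ZMod 2) (LinClause.forms F)) :=
  Module.Finite.span_of_finite (ZMod 2) (Set.finite_range _)

/-- **Monotonicity of the closure** (TR26-007 Lemma 2.7, from [EGI24]): `F ⊆ G ⇒ Cl(F) ⊆ Cl(G)` (for `G`
supported on the `n·m` pigeon bits), via the tree's `canClosure_mono`.
[cite: AlekseevGaevoy2026b, Lemma 2.7 (monotonicity, [EGI24])] -/
theorem cl_mono {n m : ℕ} (hm : 0 < m) {F G : Finset LinLit} (hFG : F ⊆ G)
    (hG : Supported (n * m) G) : cl m F ⊆ cl m G :=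
  canClosure_mono hm (Submodule.span_mono (LinClause.forms_mono hFG)) (span_forms_le_coordSub hm hG)

/-! ### The tuple-only variant (regime `k ≥ 6`).

For `k ≥ 6` and `c` just above `2/(k-1-ε)` the TOTAL mass of assignments with ANY pair collision,
`≤ C(N,2)·2^{Nm}/M ≈ N^{3-k+ε}·2^{Nm}/2`, is below the target union loss `μ^c·2^{Nm-1}`
whenever `(k-1-ε)c < k-3-ε`.  So at such a parameter point stability only has to control the deletions
caused by the FUNCTIONAL axioms (`Sym_f` tuples, the non-linear part): `CollT` below.  Pieces and niceness
stay exactly AG's (collision-free closure patterns), only the DELETION rule is restricted to tuples, so the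
tuple-only retention hypothesis is implied by Lemma 4.6 verbatim (it counts fewer violations) — and in
fact by the full retention hypothesis of `FamilyStable` itself, which is how `familyStable_of_T` (proved)
turns tuple-only stability + a pair-mass bound `π` into `FamilyStable` with loss `λ_T + π`, same `μ`. -/

/-- A violated FUNCTIONAL axiom inside `P`: `k+1` distinct pigeons of `P` whose holes lie in `Sym_f`.
[cite: AlekseevGaevoy2026b, §3 (p. 10, second axiom family: k+1 pigeons in a Sym_f tuple)] -/
def CollT (N m k : ℕ) (f : (Fin k → Hole m) → Hole m) (P : Finset ℕ) (σ : ℕ → Bool) : Prop :=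
  ∃ t : Fin (k + 1) → ℕ, Function.Injective t ∧ (∀ i, t i ∈ P ∧ t i < N) ∧
    SymF f (fun i => holeOf m σ (t i))

/-- Some two pigeons `< N` share a hole (anywhere).
[cite: AlekseevGaevoy2026b, §3 (p. 10, first axiom family: two pigeons in one hole)] -/
def PairColl (N m : ℕ) (σ : ℕ → Bool) : Prop :=
  ∃ x y : ℕ, x ≠ y ∧ x < N ∧ y < N ∧ holeOf m σ x = holeOf m σ y

/-- Tuple-survives: nice (AG's sense, unchanged) and no violated FUNCTIONAL axiom inside `Cl(F ∪ {ℓ})`.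
(Variant introduced for this formalisation: deletion restricted to the functional axioms.)
[cite: AlekseevGaevoy2026b, §4.3 (p. 15, Ψ^ρ_j)] -/
def SurvivesT (N m k : ℕ) (f : (Fin k → Hole m) → Hole m) (F : Finset LinLit) (ℓ : Finset ℕ)
    (σ : ℕ → Bool) : Prop :=
  Nice N m k f F σ ∧ ¬ CollT N m k f (cl m (insert (ℓ, true) F)) σ

/-- Tuple-only stability of one family: same shape as `FamilyStable`, with the deletion rule restricted to
functional axioms (`SurvivesT`); pieces, niceness, rank budget and the measure hypothesis unchanged.
(Variant introduced for this formalisation.) [cite: AlekseevGaevoy2026b, §4.3 (proof of Thm. 4.3, pp. 15–16)] -/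
def FamilyStableT (N m k : ℕ) (f : (Fin k → Hole m) → Hole m) (w : ℕ) (μ lam : ℝ)
    (ι : Type) (L : ι → Finset LinLit) (ℓ : ι → Finset ℕ) : Prop :=
    (∀ i, Supported (N * m) (L i) ∧ (∀ v ∈ ℓ i, v < N * m) ∧ linClauseRank (L i) ≤ w) →
    (∀ i, ∀ σ₀ : Fin (N * m) → Bool,
      (1 - μ) * (({σ : Fin (N * m) → Bool | SamePiece m (cl m (L i)) (ext (N * m) σ₀) (ext (N * m) σ) ∧
          Nice N m k f (L i) (ext (N * m) σ)} : Set _).ncard : ℝ)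
        ≤ (({σ : Fin (N * m) → Bool | SamePiece m (cl m (L i)) (ext (N * m) σ₀) (ext (N * m) σ) ∧
          SurvivesT N m k f (L i) (ℓ i) (ext (N * m) σ)} : Set _).ncard : ℝ)) →
    2 ^ (N * m - 1) ≤ ({σ : Fin (N * m) → Bool | ∃ i, Nice N m k f (L i) (ext (N * m) σ)} : Set _).ncard →
    (1 - lam) * (({σ : Fin (N * m) → Bool | ∃ i, Nice N m k f (L i) (ext (N * m) σ)} : Set _).ncard : ℝ)
      ≤ (({σ : Fin (N * m) → Bool | ∃ i, SurvivesT N m k f (L i) (ℓ i) (ext (N * m) σ)} : Set _).ncard : ℝ)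

/-- Tuple-only closure-local union stability with member cap `g`: every family of at most `g`
rank-`≤ w` systems with one query each is `FamilyStableT`. (Variant introduced for this formalisation.)
[cite: AlekseevGaevoy2026b, §4.3 (proof of Thm. 4.3, p. 15)] -/
def ClosureLocalUnionStableCappedT (N m k : ℕ) (f : (Fin k → Hole m) → Hole m) (w g : ℕ)
    (μ lam : ℝ) : Prop :=
  ∀ (ι : Type) (_ : Fintype ι), Fintype.card ι ≤ g → ∀ (L : ι → Finset LinLit) (ℓ : ι → Finset ℕ),
    FamilyStableT N m k f w μ lam ι L ℓ

end Literature.Computability.MetaComplexity.CLUS
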